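import Literature.NumberTheory.Transcendental.CurvePeriods
import Mathlib.RingTheory.Algebraic.Integral
import HarnessLib

/-!
# Periods of curve type: derived elementary relations (constant, reversed and re-chosen paths)

Companion of `Literature/NumberTheory/Transcendental/CurvePeriods.lean` (Huber–Wüstholz 2022,
Thm. 13.3 (2), rendered on explicit period symbols `(Z, ω, γ)` with the elementary relations
(R1)–(R5), `CurvePeriods.IsElementaryRelation`). The module docstring of that file makes three
claims about the reach of the boundary relation (R5) which are used to argue that the rendering
is faithful to the book's formal period space (Def. 7.6) — in particular that a symbol only
depends on the restriction of its path to `[0,1]`: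

* a symbol with a constant path is a relation (a degenerate triangle);
* `(Z, ω, γ) + (Z, ω, γ⁻) ∼ 0` for the reversed path `γ⁻(t) = γ(1 − t)` (the triangle
  `τ(a, b) = γ(a)`);
* two symbols whose paths agree on `[0,1]` differ by a combination of elementary relations (same
  triangle, two choices of the edge `e₀₁`).

This file proves the three claims (`isElementaryRelation_single_of_const`,
`exists_isElementaryRelation_add_reverse`, `exists_isElementaryRelation_sub_of_eqOn`, and the
latter in the exact format of the conclusion of `HuberWustholzCurvePeriods`,
`mem_span_sub_of_eqOn`). Only the constructors of `IsElementaryRelation` are used.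

## References

* A. Huber, G. Wüstholz, *Transcendence and Linear Relations of 1-Periods*, Cambridge Tracts in
  Mathematics 227, CUP 2022 [HuberWustholz2022], §3.3.1 (pp. 42–43 of the held text: relative
  singular homology by smooth paths), Def. 7.6 (p. 63), Thm. 13.3 (2) (p. 121).
-/

noncomputable section

open scoped BigOperators
open MvPolynomial Set

namespace Literature.NumberTheory.Transcendental

namespace CurvePeriods

variable {Z : CurveData}

/-- A point of `[0,1]` stays in `[0,1]` under `t ↦ 1 − t`. This is Mathlib's
`Set.Icc.mem_iff_one_sub_mem` (forward direction); the name is kept for its users in the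
`CurvePeriods*Proofs` files. [folklore] -/
theorem one_sub_mem_Icc {t : ℝ} (ht : t ∈ Icc (0 : ℝ) 1) : 1 - t ∈ Icc (0 : ℝ) 1 :=
  Set.Icc.mem_iff_one_sub_mem.mp ht

/-- The first coordinate of a point of the standard triangle lies in `[0,1]`. [folklore] -/
theorem fst_mem_Icc_of_mem_stdTriangle {q : ℝ × ℝ} (hq : q ∈ stdTriangle) :
    q.1 ∈ Icc (0 : ℝ) 1 :=
  ⟨hq.1, by linarith [hq.2.1, hq.2.2]⟩

/-- **A symbol with a constant path is an elementary relation** (R5 for the constant triangle;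
in the book's terms: a constant path is a chain in `Y`, hence `0` in `H₁(C, Y)`).
[cite: HuberWustholz2022, §3.3.1 (p. 42)] -/
theorem isElementaryRelation_single_of_const (hZ : Z.IsSmoothAffineCurve)
    (ω : Fin Z.n → MvPolynomial (Fin Z.n) ℂ) (h : ∀ i, HasAlgCoeffs (ω i)) (κ : CurvePath Z)
    (p : Fin Z.n → ℂ) (hκ : ∀ t ∈ Icc (0 : ℝ) 1, κ.toFun t = p) :
    IsElementaryRelation (Finsupp.single ⟨Z, hZ, ω, h, κ⟩ 1) := by
  have h0 : (0 : ℝ) ∈ Icc (0 : ℝ) 1 := ⟨le_rfl, zero_le_one⟩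
  have hp : p ∈ Z.points := hκ 0 h0 ▸ κ.mem_points 0 h0
  have hb := IsElementaryRelation.boundary Z hZ ω h (fun _ => p) contDiffOn_const
    (fun _ _ => hp) κ κ κ (fun t ht => hκ t ht) (fun t ht => hκ t ht) (fun t ht => hκ t ht)
  rwa [add_sub_cancel_right] at hb

/-- The boundary relation of the degenerate triangle `τ(a, b) = γ(a)`: for any path `e` agreeing
with `γ` on `[0,1]`, any path `r` agreeing with the reversed path `t ↦ γ(1 − t)` on `[0,1]` and
any path `κ` constant equal to `γ(0)` on `[0,1]`, `(e) + (r) − (κ)` is an elementary relation.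
[cite: HuberWustholz2022, §3.3.1 (p. 42)] -/
theorem isElementaryRelation_degenerate (hZ : Z.IsSmoothAffineCurve)
    (ω : Fin Z.n → MvPolynomial (Fin Z.n) ℂ) (h : ∀ i, HasAlgCoeffs (ω i)) (γ e r κ : CurvePath Z)
    (he : ∀ t ∈ Icc (0 : ℝ) 1, e.toFun t = γ.toFun t)
    (hr : ∀ t ∈ Icc (0 : ℝ) 1, r.toFun t = γ.toFun (1 - t))
    (hκ : ∀ t ∈ Icc (0 : ℝ) 1, κ.toFun t = γ.toFun 0) :
    IsElementaryRelation
      (Finsupp.single ⟨Z, hZ, ω, h, e⟩ 1 + Finsupp.single ⟨Z, hZ, ω, h, r⟩ 1 -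
        Finsupp.single ⟨Z, hZ, ω, h, κ⟩ 1) := by
  have hτ : ContDiffOn ℝ 1 (fun q : ℝ × ℝ => γ.toFun q.1) stdTriangle :=
    γ.contDiffOn.comp contDiff_fst.contDiffOn fun q hq => fst_mem_Icc_of_mem_stdTriangle hq
  have hτZ : MapsTo (fun q : ℝ × ℝ => γ.toFun q.1) stdTriangle Z.points :=
    fun q hq => γ.mem_points q.1 (fst_mem_Icc_of_mem_stdTriangle hq)
  exact IsElementaryRelation.boundary Z hZ ω h (fun q => γ.toFun q.1) hτ hτZ e r κ
    (fun t ht => he t ht) (fun t ht => hr t ht) (fun t ht => hκ t ht)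

/-- **Reversal**: `(Z, ω, γ) + (Z, ω, γ⁻)` is a sum of two elementary relations, for any path
`γ⁻` agreeing with `t ↦ γ(1 − t)` on `[0,1]` (in the book's terms: `γ + γ⁻ = ∂τ` is a boundary in
`H₁(C, Y)`). [cite: HuberWustholz2022, §3.3.1 (p. 42)] -/
theorem exists_isElementaryRelation_add_reverse (hZ : Z.IsSmoothAffineCurve)
    (ω : Fin Z.n → MvPolynomial (Fin Z.n) ℂ) (h : ∀ i, HasAlgCoeffs (ω i)) (γ r : CurvePath Z)
    (hr : ∀ t ∈ Icc (0 : ℝ) 1, r.toFun t = γ.toFun (1 - t)) :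
    ∃ ρ₁ ρ₂ : PeriodSymbol →₀ ℂ, IsElementaryRelation ρ₁ ∧ IsElementaryRelation ρ₂ ∧
      Finsupp.single (⟨Z, hZ, ω, h, γ⟩ : PeriodSymbol) (1 : ℂ) +
        Finsupp.single ⟨Z, hZ, ω, h, r⟩ 1 = ρ₁ + ρ₂ := by
  have h0 : (0 : ℝ) ∈ Icc (0 : ℝ) 1 := ⟨le_rfl, zero_le_one⟩
  -- the constant path at `γ(0)`
  let κ : CurvePath Z :=
    { toFun := fun _ => γ.toFun 0
      contDiffOn := contDiffOn_const
      mem_points := fun _ _ => γ.mem_points 0 h0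
      algebraic_zero := γ.algebraic_zero
      algebraic_one := γ.algebraic_zero }
  refine ⟨_, _, isElementaryRelation_degenerate hZ ω h γ γ r κ (fun _ _ => rfl) hr
    (fun _ _ => rfl), isElementaryRelation_single_of_const hZ ω h κ (γ.toFun 0) (fun _ _ => rfl),
    ?_⟩
  abel

/-- **Re-choosing the path off `[0,1]`**: two symbols whose paths agree on `[0,1]` differ by a
difference of two elementary relations (same degenerate triangle, two choices of the edge `e₀₁`).
[cite: HuberWustholz2022, §3.3.1 (p. 42)] -/
theorem exists_isElementaryRelation_sub_of_eqOn (hZ : Z.IsSmoothAffineCurve)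
    (ω : Fin Z.n → MvPolynomial (Fin Z.n) ℂ) (h : ∀ i, HasAlgCoeffs (ω i)) (γ γ' : CurvePath Z)
    (hγ' : ∀ t ∈ Icc (0 : ℝ) 1, γ'.toFun t = γ.toFun t) :
    ∃ ρ₁ ρ₂ : PeriodSymbol →₀ ℂ, IsElementaryRelation ρ₁ ∧ IsElementaryRelation ρ₂ ∧
      Finsupp.single (⟨Z, hZ, ω, h, γ⟩ : PeriodSymbol) (1 : ℂ) -
        Finsupp.single ⟨Z, hZ, ω, h, γ'⟩ 1 = ρ₁ - ρ₂ := by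
  have h0 : (0 : ℝ) ∈ Icc (0 : ℝ) 1 := ⟨le_rfl, zero_le_one⟩
  have h1 : (1 : ℝ) ∈ Icc (0 : ℝ) 1 := ⟨zero_le_one, le_rfl⟩
  -- the constant path at `γ(0)` and the reversed path
  let κ : CurvePath Z :=
    { toFun := fun _ => γ.toFun 0
      contDiffOn := contDiffOn_const
      mem_points := fun _ _ => γ.mem_points 0 h0
      algebraic_zero := γ.algebraic_zero
      algebraic_one := γ.algebraic_zero }
  let r : CurvePath Z :=
    { toFun := fun t => γ.toFun (1 - t)
      contDiffOn := γ.contDiffOn.comp (contDiff_const.sub contDiff_id).contDiffOn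
        fun t ht => one_sub_mem_Icc ht
      mem_points := fun t ht => γ.mem_points (1 - t) (one_sub_mem_Icc ht)
      algebraic_zero := fun i => by simpa using γ.algebraic_one i
      algebraic_one := fun i => by simpa using γ.algebraic_zero i }
  refine ⟨_, _, isElementaryRelation_degenerate hZ ω h γ γ r κ (fun _ _ => rfl) (fun _ _ => rfl)
    (fun _ _ => rfl), isElementaryRelation_degenerate hZ ω h γ γ' r κ hγ' (fun _ _ => rfl)
    (fun _ _ => rfl), ?_⟩
  abel

/-- The previous statement in the format of the conclusion of `HuberWustholzCurvePeriods`: the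
(vanishing, algebraic-coefficient) combination `(Z, ω, γ) − (Z, ω, γ′)` of two symbols whose paths
agree on `[0,1]` is an algebraic (indeed `±1`) combination of elementary relations.
[cite: HuberWustholz2022, §3.3.1 (p. 42), Thm. 13.3 (2) (p. 121)] -/
theorem mem_span_sub_of_eqOn (hZ : Z.IsSmoothAffineCurve)
    (ω : Fin Z.n → MvPolynomial (Fin Z.n) ℂ) (h : ∀ i, HasAlgCoeffs (ω i)) (γ γ' : CurvePath Z)
    (hγ' : ∀ t ∈ Icc (0 : ℝ) 1, γ'.toFun t = γ.toFun t) :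
    ∃ (k : ℕ) (ρ : Fin k → (PeriodSymbol →₀ ℂ)) (a : Fin k → ℂ),
      (∀ l, IsElementaryRelation (ρ l)) ∧ (∀ l, IsAlgebraic ℚ (a l)) ∧
        Finsupp.single (⟨Z, hZ, ω, h, γ⟩ : PeriodSymbol) (1 : ℂ) -
          Finsupp.single ⟨Z, hZ, ω, h, γ'⟩ 1 = ∑ l, a l • ρ l := by
  obtain ⟨ρ₁, ρ₂, h₁, h₂, he⟩ := exists_isElementaryRelation_sub_of_eqOn hZ ω h γ γ' hγ'
  refine ⟨2, ![ρ₁, ρ₂], ![1, -1], ?_, ?_, ?_⟩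
  · intro l
    fin_cases l
    · exact h₁
    · exact h₂
  · intro l
    fin_cases l
    · exact isAlgebraic_one
    · exact isAlgebraic_one.neg
  · rw [he, Fin.sum_univ_two]
    simp only [Matrix.cons_val_zero, Matrix.cons_val_one, one_smul, neg_smul, sub_eq_add_neg]

end CurvePeriods

end Literature.NumberTheory.Transcendental

end
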